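import Literature.NumberTheory.LFunctions.DirichletLTruncationCertificates
import Literature.NumberTheory.LFunctions.DirichletLTruncationPackedRoots
import Literature.NumberTheory.LFunctions.DirichletLTruncationPackedDigits
import Literature.NumberTheory.LFunctions.FeketePolyaKernelCertificatesWeighted
import HarnessLib

/-!
# Packed truncation certificates for `L(σ, χ) ≠ 0` on `(0, 1)` — the certificate

Kronecker-packed evaluation of lower bounds for the truncated Dirichlet series `A(s₀) = Σ_{n ≤ Kq} χ(n) n^{-s₀}` and of
upper bounds for the drift `D(s₀) = Σ_{N<Kq} max(0, −A_N(s₀))/N` on an explicit graded list of cells `(s₀, h) = (i/E, w/E)`,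
`E = 2^J`, covering `[1/2, 1]`; these are the inputs of `LTruncationCert.lfunction_ne_zero_of_truncation_drift` via
`LTruncation.cell_bound`. The sign digits of `χ` over `[1, Kq]` are split dyadically down to geometric leaves `[n₀, n₀+L)`,
`L ≤ max 1 ⌊n₀/G⌋`. Inside a leaf the weights of the `χ = −1` terms are bounded above by the chord through the endpoint values
and those of the `χ = +1` terms below by the tangent at the midpoint (convexity of `x ↦ x^{-s}`), so that a leaf costs five digit
statistics and, for the drift, one packed vector of running lower bounds per cell whose negative digits are summed by a block
mask. The node weights `2^P x^{-i/E}` are carried along the cell list by multiplications with `2^P x^{-1/2^j}`, obtained from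
`2^P x^{-1/2}` by verified integer square roots (Newton candidates, checked). Kernel budget: every intermediate value is retained
by the checker, so per `decide` the digit volume is `O(#cells · Kq)` words — cells are certified in groups.
[cite: Chua2005RealZeros, §2.2 ALGO 1] [cite: GathenGerhard2013ModernComputerAlgebra, §8.4 (Kronecker substitution)]
-/

namespace Literature.NumberTheory.LFunctions

namespace LTruncationPacked

open FeketePolyaKernel LTruncationCert

/-- Strict cons: forces the running pair to literals before consing (keeps kernel evaluation shallow: without it the checker
accumulates leaf-deep thunks). [folklore] -/
def fcons : ℤ → ℕ → List (ℤ × ℕ) → List (ℤ × ℕ)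
  | Int.ofNat x, 0, rest => (Int.ofNat x, 0) :: rest
  | Int.ofNat x, y + 1, rest => (Int.ofNat x, y + 1) :: rest
  | Int.negSucc x, 0, rest => (Int.negSucc x, 0) :: rest
  | Int.negSucc x, y + 1, rest => (Int.negSucc x, y + 1) :: rest

/-! ### One leaf -/

/-- The cell-independent data of a leaf `[n₀, n₀+L)`: counts and moments of the `±` positions, prefix-count vectors, root
chains at `n₀`, `n₁ = n₀ + L − 1` and the midpoint `m = n₀ + t_m`, `t_m = ⌊(L−1)/2⌋`. [cite: Chua2005RealZeros, §2.2 ALGO 1] -/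
structure LeafData where
  /-- block length -/
  L : ℕ
  /-- first index -/
  n0 : ℕ
  /-- midpoint offset -/
  tm : ℕ
  /-- number of `+` positions -/
  cp : ℕ
  /-- number of `−` positions -/
  cm : ℕ
  /-- `Σ_{+, t ≤ t_m} (t_m − t)` -/
  mL : ℕ
  /-- `Σ_{+, t > t_m} (t − t_m)` -/
  mR : ℕ
  /-- `Σ_{−} t` -/
  mm : ℕ
  /-- prefix counts of `+` positions (packed, `L` digits) -/
  Cp : ℕ
  /-- prefix counts of `−` positions (packed, `L` digits) -/
  Cm : ℕ
  /-- lower roots at `n₀` -/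
  r0l : List ℕ
  /-- upper roots at `n₀` -/
  r0h : List ℕ
  /-- upper roots at `n₁` -/
  r1h : List ℕ
  /-- lower roots at `m` -/
  rml : List ℕ

/-- Compute the leaf data from the sign digits `Dp, Dm` (`L` digits each). [cite: Chua2005RealZeros, §2.2 ALGO 1] -/
def leafData (b P J n0 L Dp Dm : ℕ) : LeafData :=
  let R := onesV b L
  let full := (1 <<< b) - 1
  let maskL := (1 <<< (b * L)) - 1
  let Jr := rampV b L R
  let tm := (L - 1) / 2
  let JL := tm * onesV b (tm + 1) - (Jr &&& ((1 <<< (b * (tm + 1))) - 1))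
  let JR := (Jr >>> (b * (tm + 1))) - tm * onesV b (L - (tm + 1))
  { L := L, n0 := n0, tm := tm,
    cp := dsum b Dp, cm := dsum b Dm,
    mL := dsum b (JL &&& (Dp * full)),
    mR := dsum b (JR &&& ((Dp >>> (b * (tm + 1))) * full)),
    mm := dsum b (Jr &&& (Dm * full)),
    Cp := (Dp * R) &&& maskL, Cm := (Dm * R) &&& maskL,
    r0l := lowRoots P J n0, r0h := upRoots P J n0, r1h := upRoots P J (n0 + L - 1), rml := lowRoots P J (n0 + tm) }

/-- One cell on one leaf. Inputs: the chain values `c0l ≤ 2^P n₀^{-s} ≤ c0h`, `2^P n₁^{-s} ≤ c1h`, `cml ≤ 2^P m^{-s}`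
(`s = i/E`), the running `(pref, d)`. Output: the new `(pref, d)` or `none` if a range check fails.
`pref += (c⁺·cml + σ⌊·mL − σ⌈·mR) − (c⁻·c0h − δ·m⁻)`; drift from the packed vector `V` of `H + pref + wlo·C⁺(t) − c0h·C⁻(t)`
(`H = 2^{b−1}`): with `U = V − (V &&& H·1)`, the block bit `2^{P+16}` of `U` marks the negative digits and their low blocks
sum to `2^{P+16}·#neg − Σ|·|`. [cite: Chua2005RealZeros, §2.2 ALGO 1] -/
def leafCell (b P E : ℕ) (ld : LeafData) (i c0l c0h c1h cml : ℕ) (pref : ℤ) (d : ℕ) : Option (ℤ × ℕ) :=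
  let L := ld.L
  let m := ld.n0 + ld.tm
  let H := 1 <<< (b - 1)
  let Bk := P + 16
  let R := onesV b L
  let δ := if L ≤ 1 then 0 else (c0l - c1h) / (L - 1)
  let σf := (i * cml) / (E * m)
  let σc := (i * cml + E * m - 1) / (E * m)
  let ΔA : ℤ := ((ld.cp * cml + σf * ld.mL : ℕ) : ℤ) - ((σc * ld.mR : ℕ) : ℤ)
      - (((ld.cm * c0h : ℕ) : ℤ) - ((δ * ld.mm : ℕ) : ℤ))
  let wlo := ((cml : ℤ) - ((L - 1 - ld.tm) * σc : ℕ)).toNat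
  let ok := Nat.ble i E && Nat.blt pref.natAbs (1 <<< (Bk - 1)) && Nat.blt c0h (1 <<< (P + 2)) &&
    Nat.blt cml (1 <<< (P + 2)) && Nat.blt L (1 <<< 12) && Nat.ble (P + 30) b && Nat.ble 1 ld.n0
  let V := ((H : ℤ) + pref).toNat * R + wlo * ld.Cp - c0h * ld.Cm
  let U := V - (V &&& (H * R))
  let NegI := (U &&& ((1 <<< Bk) * R)) >>> Bk
  let LoN := U &&& (NegI * ((1 <<< Bk) - 1))
  let negsum := (dsum b NegI <<< Bk) - dsum b LoN
  bif ok then some (pref + ΔA, d + (negsum + ld.n0 - 1) / ld.n0) else none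

/-- All cells on one leaf, carrying the four fixed-point chains along the (sorted) cell list; `iPrev` = previous
numerator (`0` at the start, chains at `2^P`). [cite: Chua2005RealZeros, §2.2 ALGO 1] -/
def leafCells (b P E : ℕ) (ld : LeafData) : ℕ → ℕ → ℕ → ℕ → ℕ → List (ℕ × ℕ) → List (ℤ × ℕ) → Option (List (ℤ × ℕ))
  | _, _, _, _, _, [], [] => some []
  | _, _, _, _, _, [], _ :: _ => none
  | _, _, _, _, _, _ :: _, [] => none
  | iPrev, c0l, c0h, c1h, cml, (i, _) :: cells, (pref, d) :: st =>
    bif Nat.blt i iPrev then none else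
    let Δ := i - iPrev
    let J1 := ld.r0l.length + 1
    let c0l' := stepLo P ld.r0l J1 c0l Δ 0
    let c0h' := stepHi P ld.r0h J1 c0h Δ 0
    let c1h' := stepHi P ld.r1h J1 c1h Δ 0
    let cml' := stepLo P ld.rml J1 cml Δ 0
    match leafCell b P E ld i c0l' c0h' c1h' cml' pref d with
    | none => none
    | some (pref', d') =>
      match leafCells b P E ld i c0l' c0h' c1h' cml' cells st with
      | none => none
      | some rest => some (fcons pref' d' rest)

/-- One leaf: leaf data, then all cells from chains `2^P` at numerator `0`. [cite: Chua2005RealZeros, §2.2 ALGO 1] -/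
def leaf (b P J n0 L Dp Dm : ℕ) (cells : List (ℕ × ℕ)) (st : List (ℤ × ℕ)) : Option (List (ℤ × ℕ)) :=
  leafCells b P (2 ^ J) (leafData b P J n0 L Dp Dm) 0 (2 ^ P) (2 ^ P) (2 ^ P) (2 ^ P) cells st

/-- Dyadic segment walk over `[n₀, n₀ + len)` (digits of `Tp, Tm`: digit `0` ↔ `n₀`) down to leaves `len ≤ max 1 ⌊n₀/G⌋`.
[cite: Chua2005RealZeros, §2.2 ALGO 1] -/
def seg (b P J G : ℕ) (cells : List (ℕ × ℕ)) : ℕ → ℕ → ℕ → ℕ → ℕ → List (ℤ × ℕ) → Option (List (ℤ × ℕ))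
  | 0, n0, len, Tp, Tm, st => bif Nat.beq len 0 then some st else leaf b P J n0 len Tp Tm cells st
  | e + 1, n0, len, Tp, Tm, st =>
    bif Nat.beq len 0 then some st else
    bif Nat.ble len (max 1 (n0 / G)) then leaf b P J n0 len Tp Tm cells st else
    let h := len / 2
    match seg b P J G cells e n0 h (Tp &&& ((1 <<< (b * h)) - 1)) (Tm &&& ((1 <<< (b * h)) - 1)) st with
    | none => none
    | some st' => seg b P J G cells e (n0 + h) (len - h) (Tp >>> (b * h)) (Tm >>> (b * h)) st'

/-! ### Cells, coverage, the certificate -/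

/-- Final per-cell inequality: `a ≥ 0` and `2r(M+1)·(E·a·ρ_w − w·d·2^P) > E·4^P·B⁻` with `ρ_w = ⌊lo_M^w/2^{P(w−1)}⌋ ≤ 2^P M^{-w/E}`
(`a ≤ 2^P A(s₀)`, `d ≥ 2^P D(s₀)`, `h = w/E`: this is `A M^{-h} − h D > B⁻/(2r(M+1))`). [cite: Chua2005RealZeros, §2.2 ALGO 1] -/
def cellOK (P E M r Bm loM : ℕ) (iw : ℕ × ℕ) (ad : ℤ × ℕ) : Bool :=
  let ρ := loM ^ iw.2 / 2 ^ (P * (iw.2 - 1))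
  decide (0 ≤ ad.1) && Nat.ble 1 iw.2 &&
    Nat.blt (E * 2 ^ P * 2 ^ P * Bm) (2 * r * (M + 1) * (E * ad.1.toNat * ρ - iw.2 * ad.2 * 2 ^ P))

/-- All cells pass. [cite: Chua2005RealZeros, §2.2 ALGO 1] -/
def cellsOK (P E M r Bm loM : ℕ) : List (ℕ × ℕ) → List (ℤ × ℕ) → Bool
  | [], [] => true
  | iw :: iws, ad :: ads => cellOK P E M r Bm loM iw ad && cellsOK P E M r Bm loM iws ads
  | _, _ => false

/-- Coverage of `[1/2, 1]` by the cells `(i, w) ↔ [i/E, (i+w)/E]`: every cell starts at or before the covered frontier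
(initially `E/2`), and the frontier reaches `E`. [cite: Chua2005RealZeros, §2.2 ALGO 1] -/
def covers (E : ℕ) : ℕ → List (ℕ × ℕ) → Bool
  | cur, [] => Nat.ble E cur
  | cur, (i, w) :: rest => Nat.ble i cur && covers E (max cur (i + w)) rest

/-- **Cell-group certificate.** `PM` = sign tables of `χ` over one period (`q` digits, width `b`); `K` periods (`M = Kq`),
precision `P`, mesh `E = 2^J`, geometric leaf ratio `G`, `B⁻ = Bm`: the cells of THIS group pass their inequalities.
[cite: Chua2005RealZeros, §2.2 ALGO 1] -/
def certTcells (b P J G q K Bm : ℕ) (cells : List (ℕ × ℕ)) (PM : ℕ × ℕ) : Bool :=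
  let M := K * q
  let E := 2 ^ J
  let TP := pextS b q (K + 1) PM.1 &&& ((1 <<< (b * (M + 1))) - 1)
  let TM := pextS b q (K + 1) PM.2 &&& ((1 <<< (b * (M + 1))) - 1)
  let st0 : List (ℤ × ℕ) := cells.map fun _ => ((0 : ℤ), (0 : ℕ))
  Nat.ble 7 q && Nat.ble 1 K && Nat.ble 1 J && Nat.ble 16 b &&
  (match seg b P J G cells 24 1 M (TP >>> b) (TM >>> b) st0 with
    | none => false
    | some st => cellsOK P E M (isqrtSucc M) Bm (rootEnc M E P).1 cells st)

/-- **Frame certificate.** Coverage of `[1/2, 1]` by all cells of all groups, and the `U`-walk (`walkD` on `x + B⁻(δ₁ − δ₂)`,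
splitting depth `e`): `U(N) ≥ −B⁻` for `N < q` and `U(q) ≥ 0`. [cite: Chua2005RealZeros, §2.2 ALGO 1] -/
def certTframe (b e J q Bm : ℕ) (cells : List (ℕ × ℕ)) (PM : ℕ × ℕ) : Bool :=
  let E := 2 ^ J
  let Wp := PM.1 + (Bm <<< b)
  let Wm := PM.2 + (Bm <<< (2 * b))
  Nat.ble 7 q && Nat.ble 1 J && Nat.ble 16 b && Nat.blt Bm (1 <<< (b - 2)) &&
  covers E (E / 2) cells &&
  (match walkD b (Bm + 1) e q Wp Wm [0, 0] with
    | some [s1, u2] => decide (0 ≤ u2 - (Bm : ℤ) + s1)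
    | _ => false)

end LTruncationPacked

end Literature.NumberTheory.LFunctions
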